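import Summits.ValiantsHypothesis.ValiantsHypothesis.Theorems.DefinabilityGapBlockedMGF
import Summits.ValiantsHypothesis.ValiantsHypothesis.Theorems.DefinabilityGapPivotColumn
import Summits.ValiantsHypothesis.ValiantsHypothesis.Theorems.DefinabilityGapPairWeightBound
import Mathlib.Analysis.Convex.SpecificFunctions.Basic
import HarnessLib

/-!
# Definability gap, ROAD P: exponential tail for blocked pivot rows of EVERY curve

PLAN (d) v3 (H1), second half (NODE-v7 §I): from the MGF domination of
`DefinabilityGapBlockedMGF` we derive
* `chernoff_of_mgf_le` — a generic Bernstein-form tail `exp(−t²/(2(μ + t/3)))` for any statistic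
  whose MGF is dominated by `exp((e^θ − 1) μ)` (the Poisson/Bennett MGF), via `sq_div_le_hFun`;
* `weight_manyBlockedBy_le` — the abstract tail for `#blockedBy`;
* the PIVOT INSTANTIATION: hit sets `hitSet T c s₀ A c' a = {a}` when `c'` is a co-curve of `c`
  through the column-`s₀` cell of row `a ∈ A`; `blockedBy (hitSet …) univ r = blockedRows ∩ A`
  (`blockedBy_hitSet`); the tail `weight_manyBlockedRows_le`:
  `W{μ + t ≤ #(blockedRows T c r s₀ ∩ A)} ≤ exp(−t²/(2(μ + t/3)))` whenever
  `Σ_{ρ∈A} (1 − ∏_{c' ∈ coCurves T c (ρ,s₀)} (1 − w c' ρ)) ≤ μ`;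
* the MEAN BOUND `sum_one_sub_prod_le`: that sum is at most `#A − #A · exp(−2 p · colLoad/#A)`
  for point weights `≤ p ≤ 1/2` (Jensen) — LINEAR room `#A · e^{−2p·colLoad/#A}` for every curve,
  hubs included, which is what lets every mover re-pick in the three-round alteration.
-/

namespace Summit.ValiantsHypothesis.ValiantsHypothesis.Theorems.DefinabilityGapBlockedTail

open Finset Real Literature.Probability.Moments
open Literature.Computability.AlgebraicComplexity Literature.Computability.MetaComplexity
open Summit.ValiantsHypothesis.ValiantsHypothesis.Theorems.DefinabilityGapAffineRung
open Summit.ValiantsHypothesis.ValiantsHypothesis.Theorems.DefinabilityGapPivotAdmissible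
open Summit.ValiantsHypothesis.ValiantsHypothesis.Theorems.DefinabilityGapCrowdedFree
open Summit.ValiantsHypothesis.ValiantsHypothesis.Theorems.DefinabilityGapPivotColumn
open Summit.ValiantsHypothesis.ValiantsHypothesis.Theorems.DefinabilityGapPairWeightBound
open Summit.ValiantsHypothesis.ValiantsHypothesis.Theorems.DefinabilityGapBlockedMGF

section Generic

variable {ι Γ R : Type*} [Fintype ι] [DecidableEq ι] [Fintype Γ] [Fintype R] [DecidableEq R]

/-- **Chernoff from a dominated MGF** (Bernstein form): if `E[e^{θX}] ≤ exp((e^θ − 1) μ)` for all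
`θ ≥ 0`, then `W{μ + t ≤ X} ≤ exp(−t²/(2(μ + t/3)))`. [lens-5 g7] -/
theorem chernoff_of_mgf_le {w : ι → Γ → ℝ} (hw : ∀ i a, 0 ≤ w i a) (X : (ι → Γ) → ℝ) {μ : ℝ}
    (hμ : 0 < μ)
    (hM : ∀ θ : ℝ, 0 ≤ θ → ∑ y, prodWeight w y * exp (θ * X y) ≤ exp ((exp θ - 1) * μ))
    {t : ℝ} (ht : 0 < t) :
    ∑ y ∈ univ.filter (fun y => μ + t ≤ X y), prodWeight w y ≤
      exp (-(t ^ 2 / (2 * (μ + t / 3)))) := by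
  classical
  set u : ℝ := t / μ with hu
  have hu0 : 0 < u := div_pos ht hμ
  set θ : ℝ := log (1 + u) with hθ
  have hθ0 : 0 < θ := Real.log_pos (by linarith)
  set E := univ.filter (fun y => μ + t ≤ X y) with hE
  have hW : ∀ y : ι → Γ, 0 ≤ prodWeight w y := prodWeight_nonneg hw
  have h1 : (∑ y ∈ E, prodWeight w y) * exp (θ * (μ + t)) ≤
      ∑ y, prodWeight w y * exp (θ * X y) := by
    rw [sum_mul]
    refine (sum_le_sum fun y hy => ?_).trans
      (sum_le_sum_of_subset_of_nonneg (filter_subset _ _) fun y _ _ =>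
        mul_nonneg (hW y) (exp_pos _).le)
    rw [hE, mem_filter] at hy
    exact mul_le_mul_of_nonneg_left (exp_le_exp.2 (mul_le_mul_of_nonneg_left hy.2 hθ0.le))
      (hW y)
  have h2 : ∑ y ∈ E, prodWeight w y ≤ exp ((exp θ - 1) * μ - θ * (μ + t)) := by
    rw [Real.exp_sub, le_div_iff₀ (exp_pos _)]
    exact h1.trans (hM θ hθ0.le)
  have hexp : exp θ = 1 + u := by rw [hθ, Real.exp_log (by linarith)]
  have hμ' : μ ≠ 0 := hμ.ne'
  have h3 : (exp θ - 1) * μ - θ * (μ + t) = -(μ * ((1 + u) * log (1 + u) - u)) := by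
    rw [hexp, hθ]
    have ht' : t = u * μ := by rw [hu]; field_simp
    rw [ht']; ring
  rw [h3] at h2
  refine h2.trans (exp_le_exp.2 ?_)
  have hh := sq_div_le_hFun hu0.le
  have hkey : t ^ 2 / (2 * (μ + t / 3)) = μ * (u ^ 2 / (2 * (1 + u / 3))) := by
    rw [hu]; field_simp
  rw [hkey]
  exact neg_le_neg (mul_le_mul_of_nonneg_left hh hμ.le)

omit [Fintype R] [DecidableEq R] in
/-- `∏ (1 + x) ≤ exp(Σ x)` for `x ≥ 0`. [lens-5 g7] -/
theorem prod_one_add_le_exp_sum (s : Finset R) (x : R → ℝ) (hx : ∀ ρ ∈ s, 0 ≤ x ρ) :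
    ∏ ρ ∈ s, (1 + x ρ) ≤ exp (∑ ρ ∈ s, x ρ) := by
  rw [Real.exp_sum]
  exact prod_le_prod (fun ρ h => by linarith [hx ρ h]) fun ρ _ => by
    linarith [add_one_le_exp (x ρ)]

/-- The MGF of `#blockedBy` is at most the Poisson MGF `exp((e^θ − 1) μ)` once
`Σ_ρ (1 − ∏_j (1 − hitProb j ρ)) ≤ μ`. [lens-5 g7] -/
theorem mgf_blockedBy_le_exp {w : ι → Γ → ℝ} (hw : ∀ i a, 0 ≤ w i a)
    (hw1 : ∀ i, ∑ a, w i a = 1) (h : ι → Γ → Finset R) (hh : ∀ j a, #(h j a) ≤ 1)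
    (S : Finset ι) {μ : ℝ} (hμ : ∑ ρ, (1 - ∏ j ∈ S, (1 - hitProb w h j ρ)) ≤ μ) {θ : ℝ}
    (hθ : 0 ≤ θ) :
    ∑ y, prodWeight w y * exp (θ * #(blockedBy h S y)) ≤ exp ((exp θ - 1) * μ) := by
  have he1 : 0 ≤ exp θ - 1 := by linarith [Real.one_le_exp hθ]
  have hπ1 : ∀ ρ, ∏ j ∈ S, (1 - hitProb w h j ρ) ≤ 1 := fun ρ =>
    prod_le_one (fun j _ => sub_nonneg.mpr (hitProb_le_one hw hw1 h j ρ))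
      fun j _ => by linarith [hitProb_nonneg hw h j ρ]
  refine (mgf_blocked_exp_le hw hw1 h hh hθ S).trans ?_
  have hrw : ∀ ρ, exp θ - (exp θ - 1) * ∏ j ∈ S, (1 - hitProb w h j ρ) =
      1 + (exp θ - 1) * (1 - ∏ j ∈ S, (1 - hitProb w h j ρ)) := fun ρ => by ring
  simp_rw [hrw]
  refine (prod_one_add_le_exp_sum univ _ fun ρ _ =>
    mul_nonneg he1 (sub_nonneg.mpr (hπ1 ρ))).trans (exp_le_exp.2 ?_)
  rw [← mul_sum]
  exact mul_le_mul_of_nonneg_left hμ he1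

/-- **Tail for `#blockedBy`**: `W{μ + t ≤ #blockedBy h S y} ≤ exp(−t²/(2(μ + t/3)))`.
[lens-5 g7] -/
theorem weight_manyBlockedBy_le {w : ι → Γ → ℝ} (hw : ∀ i a, 0 ≤ w i a)
    (hw1 : ∀ i, ∑ a, w i a = 1) (h : ι → Γ → Finset R) (hh : ∀ j a, #(h j a) ≤ 1)
    (S : Finset ι) {μ : ℝ} (hμ0 : 0 < μ)
    (hμ : ∑ ρ, (1 - ∏ j ∈ S, (1 - hitProb w h j ρ)) ≤ μ) {t : ℝ} (ht : 0 < t) :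
    ∑ y ∈ univ.filter (fun y => μ + t ≤ (#(blockedBy h S y) : ℝ)), prodWeight w y ≤
      exp (-(t ^ 2 / (2 * (μ + t / 3)))) :=
  chernoff_of_mgf_le hw (fun y => (#(blockedBy h S y) : ℝ)) hμ0
    (fun _ hθ => mgf_blockedBy_le_exp hw hw1 h hh S hμ hθ) ht

end Generic

/-! ## The pivot instantiation -/

section Pivot

variable {m : ℕ}

/-- Hit sets: co-curve `c'` pivoting in row `a ∈ A` hits the target row `a` of `c`
(column `s₀`). [lens-5 g7] -/
noncomputable def hitSet (T : Finset (Fin 3 → Fin (qOf m))) (c : Fin 3 → Fin (qOf m)) (s₀ : Fin m)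
    (A : Finset (Fin m)) (c' : Fin 3 → Fin (qOf m)) (a : Fin m) : Finset (Fin m) :=
  if c' ∈ coCurves T c (a, s₀) ∧ a ∈ A then {a} else ∅

/-- A coordinate hits at most one target. [lens-5 g7] -/
theorem card_hitSet_le (T : Finset (Fin 3 → Fin (qOf m))) (c : Fin 3 → Fin (qOf m))
    (s₀ : Fin m) (A : Finset (Fin m)) (c' : Fin 3 → Fin (qOf m)) (a : Fin m) :
    #(hitSet T c s₀ A c' a) ≤ 1 := by
  unfold hitSet
  split_ifs <;> simp

/-- Membership in a hit set. [lens-5 g7] -/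
theorem mem_hitSet {T : Finset (Fin 3 → Fin (qOf m))} {c : Fin 3 → Fin (qOf m)} {s₀ : Fin m}
    {A : Finset (Fin m)} {c' : Fin 3 → Fin (qOf m)} {a ρ : Fin m} :
    ρ ∈ hitSet T c s₀ A c' a ↔ (c' ∈ coCurves T c (a, s₀) ∧ a ∈ A) ∧ ρ = a := by
  unfold hitSet
  split_ifs with h
  · simp [h]
  · simp [h]

/-- Blocked targets of the hit sets = blocked rows in `A`. [lens-5 g7] -/
theorem blockedBy_hitSet (T : Finset (Fin 3 → Fin (qOf m))) (c : Fin 3 → Fin (qOf m))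
    (s₀ : Fin m) (A : Finset (Fin m)) (r : (Fin 3 → Fin (qOf m)) → Fin m) :
    blockedBy (hitSet T c s₀ A) univ r = blockedRows T c r s₀ ∩ A := by
  ext ρ
  rw [mem_blockedBy, mem_inter, mem_blockedRows]
  constructor
  · rintro ⟨c', -, hc'⟩
    rw [mem_hitSet] at hc'
    obtain ⟨⟨hco, hA⟩, rfl⟩ := hc'
    exact ⟨⟨c', hco, rfl⟩, hA⟩
  · rintro ⟨⟨c', hco, hrc⟩, hA⟩
    refine ⟨c', mem_univ _, ?_⟩
    rw [mem_hitSet]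
    subst hrc
    exact ⟨⟨hco, hA⟩, rfl⟩

/-- Hit probabilities of the hit sets. [lens-5 g7] -/
theorem hitProb_hitSet (w : (Fin 3 → Fin (qOf m)) → Fin m → ℝ)
    (T : Finset (Fin 3 → Fin (qOf m))) (c : Fin 3 → Fin (qOf m)) (s₀ : Fin m)
    (A : Finset (Fin m)) (c' : Fin 3 → Fin (qOf m)) (ρ : Fin m) :
    hitProb w (hitSet T c s₀ A) c' ρ =
      if c' ∈ coCurves T c (ρ, s₀) ∧ ρ ∈ A then w c' ρ else 0 := by
  unfold hitProb
  rw [Finset.sum_eq_single ρ]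
  · by_cases h : c' ∈ coCurves T c (ρ, s₀) ∧ ρ ∈ A
    · rw [if_pos h, if_pos (mem_hitSet.mpr ⟨h, rfl⟩), mul_one]
    · rw [if_neg h, if_neg (fun hm => h (mem_hitSet.mp hm).1), mul_zero]
  · intro a _ hne
    rw [if_neg (fun hm => hne (mem_hitSet.mp hm).2.symm), mul_zero]
  · exact fun h => absurd (mem_univ ρ) h

/-- The independent-model blocking probability of a target row. [lens-5 g7] -/
theorem one_sub_prod_hitSet (w : (Fin 3 → Fin (qOf m)) → Fin m → ℝ)
    (T : Finset (Fin 3 → Fin (qOf m))) (c : Fin 3 → Fin (qOf m)) (s₀ : Fin m)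
    (A : Finset (Fin m)) (ρ : Fin m) :
    (1 - ∏ c' ∈ univ, (1 - hitProb w (hitSet T c s₀ A) c' ρ)) =
      if ρ ∈ A then 1 - ∏ c' ∈ coCurves T c (ρ, s₀), (1 - w c' ρ) else 0 := by
  simp_rw [hitProb_hitSet]
  by_cases hA : ρ ∈ A
  · rw [if_pos hA]
    have hf : ∀ c' : Fin 3 → Fin (qOf m),
        (1 - if c' ∈ coCurves T c (ρ, s₀) ∧ ρ ∈ A then w c' ρ else 0) =
          if c' ∈ coCurves T c (ρ, s₀) then 1 - w c' ρ else 1 := fun c' => by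
      by_cases hc : c' ∈ coCurves T c (ρ, s₀) <;> simp [hc, hA]
    simp_rw [hf]
    rw [prod_ite_mem, univ_inter]
  · rw [if_neg hA]
    have hf : ∀ c' : Fin 3 → Fin (qOf m),
        (1 - if c' ∈ coCurves T c (ρ, s₀) ∧ ρ ∈ A then w c' ρ else 0) = 1 := fun c' => by
      simp [hA]
    simp_rw [hf]
    simp

/-- Summing the blocking probabilities over the targets. [lens-5 g7] -/
theorem sum_one_sub_prod_hitSet (w : (Fin 3 → Fin (qOf m)) → Fin m → ℝ)
    (T : Finset (Fin 3 → Fin (qOf m))) (c : Fin 3 → Fin (qOf m)) (s₀ : Fin m)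
    (A : Finset (Fin m)) :
    ∑ ρ, (1 - ∏ c' ∈ univ, (1 - hitProb w (hitSet T c s₀ A) c' ρ)) =
      ∑ ρ ∈ A, (1 - ∏ c' ∈ coCurves T c (ρ, s₀), (1 - w c' ρ)) := by
  simp_rw [one_sub_prod_hitSet]
  rw [← sum_filter, Finset.filter_mem_eq_inter, univ_inter]

/-- **TAIL FOR BLOCKED PIVOT ROWS (every curve)**: if
`Σ_{ρ∈A} (1 − ∏_{c' ∈ coCurves T c (ρ,s₀)} (1 − w c' ρ)) ≤ μ` then
`W{μ + t ≤ #(blockedRows T c r s₀ ∩ A)} ≤ exp(−t²/(2(μ + t/3)))`. [lens-5 g7] -/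
theorem weight_manyBlockedRows_le {w : (Fin 3 → Fin (qOf m)) → Fin m → ℝ}
    (hw : ∀ b a, 0 ≤ w b a) (hw1 : ∀ b, ∑ a, w b a = 1) (T : Finset (Fin 3 → Fin (qOf m)))
    (c : Fin 3 → Fin (qOf m)) (s₀ : Fin m) (A : Finset (Fin m)) {μ : ℝ} (hμ0 : 0 < μ)
    (hμ : ∑ ρ ∈ A, (1 - ∏ c' ∈ coCurves T c (ρ, s₀), (1 - w c' ρ)) ≤ μ) {t : ℝ} (ht : 0 < t) :
    ∑ r ∈ univ.filter (fun r => μ + t ≤ (#(blockedRows T c r s₀ ∩ A) : ℝ)), prodWeight w r ≤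
      exp (-(t ^ 2 / (2 * (μ + t / 3)))) := by
  have hμ' : ∑ ρ, (1 - ∏ c' ∈ univ, (1 - hitProb w (hitSet T c s₀ A) c' ρ)) ≤ μ := by
    rw [sum_one_sub_prod_hitSet]; exact hμ
  have key := weight_manyBlockedBy_le hw hw1 (hitSet T c s₀ A) (card_hitSet_le T c s₀ A)
    univ hμ0 hμ' ht
  simp_rw [blockedBy_hitSet] at key
  exact key

/-- **MEAN BOUND** (Jensen): for point weights `≤ p ≤ 1/2` and `A` nonempty,
`Σ_{ρ∈A} (1 − ∏_{c'∈coCurves(ρ,s₀)} (1 − w c' ρ)) ≤ #A − #A · exp(−2 p · colLoad T c s₀ / #A)`.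
[lens-5 g7] -/
theorem sum_one_sub_prod_le {w : (Fin 3 → Fin (qOf m)) → Fin m → ℝ} {p : ℝ} (hp0 : 0 ≤ p)
    (hp : p ≤ 1 / 2) (hwp : ∀ b a, w b a ≤ p) (T : Finset (Fin 3 → Fin (qOf m)))
    (c : Fin 3 → Fin (qOf m)) (s₀ : Fin m) {A : Finset (Fin m)} (hA : A.Nonempty) :
    ∑ ρ ∈ A, (1 - ∏ c' ∈ coCurves T c (ρ, s₀), (1 - w c' ρ)) ≤
      #A - #A * exp (-(2 * p * colLoad T c s₀ / #A)) := by
  have hA0 : (0 : ℝ) < #A := by exact_mod_cast hA.card_pos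
  have hA1 : (#A : ℝ) ≠ 0 := hA0.ne'
  -- each product is at least `exp(−2p · #coCurves)`
  have h1 : ∀ ρ ∈ A, exp (-(2 * p * #(coCurves T c (ρ, s₀)))) ≤
      ∏ c' ∈ coCurves T c (ρ, s₀), (1 - w c' ρ) := fun ρ _ =>
    exp_neg_le_prod_one_sub (coCurves T c (ρ, s₀)) (fun c' => w c' ρ) hp0 hp
      (fun c' _ => hwp c' ρ) le_rfl
  -- Jensen for `exp`
  have h2 : #A * exp (1 / #A * ∑ ρ ∈ A, -(2 * p * (#(coCurves T c (ρ, s₀)) : ℝ))) ≤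
      ∑ ρ ∈ A, exp (-(2 * p * #(coCurves T c (ρ, s₀)))) := by
    have hJ := (convexOn_exp).map_sum_le (t := A) (w := fun _ => 1 / (#A : ℝ))
      (p := fun ρ => -(2 * p * (#(coCurves T c (ρ, s₀)) : ℝ)))
      (fun _ _ => by positivity) (by
        rw [sum_const, nsmul_eq_mul]; field_simp) (fun _ _ => Set.mem_univ _)
    simp only [smul_eq_mul] at hJ
    rw [← mul_sum, ← mul_sum] at hJ
    calc (#A : ℝ) * exp (1 / #A * ∑ ρ ∈ A, -(2 * p * (#(coCurves T c (ρ, s₀)) : ℝ)))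
        ≤ #A * (1 / #A * ∑ ρ ∈ A, exp (-(2 * p * (#(coCurves T c (ρ, s₀)) : ℝ)))) :=
          mul_le_mul_of_nonneg_left hJ hA0.le
      _ = ∑ ρ ∈ A, exp (-(2 * p * #(coCurves T c (ρ, s₀)))) := by
          field_simp
  -- the average multiplicity is at most `colLoad / #A`
  have h3 : -(2 * p * colLoad T c s₀ / #A) ≤
      1 / #A * ∑ ρ ∈ A, -(2 * p * (#(coCurves T c (ρ, s₀)) : ℝ)) := by
    have hsum : (∑ ρ ∈ A, (#(coCurves T c (ρ, s₀)) : ℝ)) ≤ colLoad T c s₀ := by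
      unfold colLoad
      push_cast
      exact sum_le_univ_sum_of_nonneg fun ρ => Nat.cast_nonneg _
    have : ∑ ρ ∈ A, -(2 * p * (#(coCurves T c (ρ, s₀)) : ℝ)) =
        -(2 * p) * ∑ ρ ∈ A, (#(coCurves T c (ρ, s₀)) : ℝ) := by
      rw [mul_sum]; exact sum_congr rfl fun ρ _ => by ring
    rw [this, show -(2 * p * (colLoad T c s₀ : ℝ) / #A) =
      1 / #A * (-(2 * p) * colLoad T c s₀) by ring]
    refine mul_le_mul_of_nonneg_left ?_ (by positivity)
    nlinarith [hsum, hp0]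
  have h4 : #A * exp (-(2 * p * colLoad T c s₀ / #A)) ≤
      ∑ ρ ∈ A, ∏ c' ∈ coCurves T c (ρ, s₀), (1 - w c' ρ) :=
    calc #A * exp (-(2 * p * colLoad T c s₀ / #A))
        ≤ #A * exp (1 / #A * ∑ ρ ∈ A, -(2 * p * (#(coCurves T c (ρ, s₀)) : ℝ))) :=
          mul_le_mul_of_nonneg_left (exp_le_exp.2 h3) hA0.le
      _ ≤ ∑ ρ ∈ A, exp (-(2 * p * #(coCurves T c (ρ, s₀)))) := h2
      _ ≤ ∑ ρ ∈ A, ∏ c' ∈ coCurves T c (ρ, s₀), (1 - w c' ρ) := sum_le_sum h1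
  rw [sum_sub_distrib, sum_const, nsmul_eq_mul, mul_one]
  linarith

end Pivot

end Summit.ValiantsHypothesis.ValiantsHypothesis.Theorems.DefinabilityGapBlockedTail
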